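import Summits.AtomisticToContinuum.Crystallization.Theorems.ExcessDecayLiouvilleParamArithD

/-!
# Route `ExcessDecayLiouville`: the numerical conditions of the final parameter choice, I (pure arithmetic, F)

Harmonic-replacement architecture for item `ExcessDecay` (stmt-AtomisticToContinuum-9334), nonlinear half.
In the regime `L¹⁰⁰⁰ ≤ δ¹⁰ r`, `L¹⁰⁰⁰ ε ≤ δ` (`L = lcOf κ ≥ 1/κ`): the elementary facts about `ε, r`, the base
threshold, the phase-one thresholds, and the derived shapes of the phase-one outputs.
All `[folklore]`; pure real inequalities, nothing here closes an item.
-/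

namespace Summit.AtomisticToContinuum.Crystallization.Theorems.ExcessDecayLiouville

/-- Killer with one `ε`: `c L^a ε ≤ 1` for `c ≤ L`, `a + 1 ≤ 1000`, `L¹⁰⁰⁰ε ≤ δ ≤ 1`. [folklore] -/
theorem killD {L δ ε c : ℝ} {a : ℕ} (hL : 1 ≤ L) (hδ1 : δ ≤ 1) (hε0 : 0 ≤ ε) (hε : L ^ 1000 * ε ≤ δ)
    (hc : c ≤ L) (ha : a + 1 ≤ 1000) : c * L ^ a * ε ≤ 1 := by
  have hL0 : 0 < L := by linarith
  by_cases hc0 : c ≤ 0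
  · exact le_trans (mul_nonpos_of_nonpos_of_nonneg (mul_nonpos_of_nonpos_of_nonneg hc0 (by positivity)) hε0) zero_le_one
  · push Not at hc0
    calc c * L ^ a * ε ≤ L * L ^ a * ε := by gcongr
      _ = L ^ (a + 1) * ε := by ring
      _ ≤ L ^ 1000 * ε := mul_le_mul_of_nonneg_right (pow_le_pow_right₀ hL ha) hε0
      _ ≤ 1 := hε.trans hδ1

/-- Numerical constants below a power of `L`. [folklore] -/
theorem const_le_pow {L c : ℝ} {m : ℕ} (hL : 239000000 ≤ L) (hc : c ≤ 239000000 ^ m) : c ≤ L ^ m :=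
  hc.trans (pow_le_pow_left₀ (by norm_num) hL m)

/-- Killer, general constant: `c L^a / (δ^j r^k) ≤ 1` for `c ≤ L^m`, `a + m ≤ 1000k`, `j ≤ 10k`. [folklore] -/
theorem killB2 {L δ r c : ℝ} {a j k m : ℕ} (hL : 1 ≤ L) (hδ : 0 < δ) (hδ1 : δ ≤ 1) (hr : L ^ 1000 ≤ δ ^ 10 * r)
    (hc : c ≤ L ^ m) (hak : a + m ≤ 1000 * k) (hjk : j ≤ 10 * k) : c * L ^ a / (δ ^ j * r ^ k) ≤ 1 := by
  have hL0 : 0 < L := by linarith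
  have hd : 0 < δ ^ 10 := by positivity
  have h1 : 0 < δ ^ 10 * r := lt_of_lt_of_le (by positivity) hr
  have hr0 : 0 < r := by
    by_contra h
    push Not at h
    have := mul_le_mul_of_nonneg_left h hd.le
    linarith
  have hden : L ^ (1000 * k) ≤ δ ^ j * r ^ k := by
    calc L ^ (1000 * k) = (L ^ 1000) ^ k := by rw [pow_mul]
      _ ≤ (δ ^ 10 * r) ^ k := pow_le_pow_left₀ (by positivity) hr k
      _ = δ ^ (10 * k) * r ^ k := by rw [mul_pow, ← pow_mul]
      _ ≤ δ ^ j * r ^ k := mul_le_mul_of_nonneg_right (pow_le_pow_of_le_one hδ.le hδ1 hjk) (by positivity)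
  have hden0 : 0 < δ ^ j * r ^ k := by positivity
  rw [div_le_one hden0]
  by_cases hc0 : c ≤ 0
  · exact le_trans (mul_nonpos_of_nonpos_of_nonneg hc0 (by positivity)) hden0.le
  · push Not at hc0
    calc c * L ^ a ≤ L ^ m * L ^ a := mul_le_mul_of_nonneg_right hc (by positivity)
      _ = L ^ (a + m) := by ring
      _ ≤ L ^ (1000 * k) := pow_le_pow_right₀ hL hak
      _ ≤ δ ^ j * r ^ k := hden

/-- Killer, general constant: `c L^a ε ≤ 1` for `c ≤ L^m`, `a + m ≤ 1000`. [folklore] -/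
theorem killD2 {L δ ε c : ℝ} {a m : ℕ} (hL : 1 ≤ L) (hδ1 : δ ≤ 1) (hε0 : 0 ≤ ε) (hε : L ^ 1000 * ε ≤ δ)
    (hc : c ≤ L ^ m) (ha : a + m ≤ 1000) : c * L ^ a * ε ≤ 1 := by
  have hL0 : 0 < L := by linarith
  by_cases hc0 : c ≤ 0
  · exact le_trans (mul_nonpos_of_nonpos_of_nonneg (mul_nonpos_of_nonpos_of_nonneg hc0 (by positivity)) hε0) zero_le_one
  · push Not at hc0
    calc c * L ^ a * ε ≤ L ^ m * L ^ a * ε := by gcongr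
      _ = L ^ (a + m) * ε := by ring
      _ ≤ L ^ 1000 * ε := mul_le_mul_of_nonneg_right (pow_le_pow_right₀ hL ha) hε0
      _ ≤ 1 := hε.trans hδ1

/-- Killer, general constant: `c L^a (1/r)^k ≤ 1` for `c ≤ L^m`, `a + m ≤ 1000k`. [folklore] -/
theorem killA2 {L δ r c : ℝ} {a k m : ℕ} (hL : 1 ≤ L) (hδ : 0 < δ) (hδ1 : δ ≤ 1) (hr : L ^ 1000 ≤ δ ^ 10 * r)
    (hc : c ≤ L ^ m) (hak : a + m ≤ 1000 * k) : c * L ^ a * (1 / r) ^ k ≤ 1 := by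
  have h := killB2 (j := 0) hL hδ hδ1 hr hc hak (Nat.zero_le _)
  rw [pow_zero, one_mul] at h
  rwa [div_pow, one_pow, ← div_eq_mul_one_div]

/-- `X ≤ κ²/c` from `2 c L² X ≤ 2`, i.e. from `c L² X ≤ 1` (`κ ≥ 1/L`). [folklore] -/
theorem le_kappa_sq_div {κ L X c : ℝ} (hκ : 0 < κ) (hκL : 1 / κ ≤ L) (hc : 0 < c) (h : c * L ^ 2 * X ≤ 1) :
    X ≤ κ ^ 2 / c := by
  have hL0 : 0 < L := lt_of_lt_of_le (by positivity) hκL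
  have hκL' : 1 ≤ κ * L := by rw [div_le_iff₀ hκ] at hκL; linarith
  rw [le_div_iff₀ hc]
  have h1 : X * c ≤ 1 / L ^ 2 := by
    rw [le_div_iff₀ (by positivity)]; linarith
  have h2 : 1 / L ^ 2 ≤ κ ^ 2 := by
    rw [div_le_iff₀ (by positivity)]; nlinarith
  linarith

/-- `X ≤ κ/c` from `c L X ≤ 1` (`κ ≥ 1/L`). [folklore] -/
theorem le_kappa_div {κ L X c : ℝ} (hκ : 0 < κ) (hκL : 1 / κ ≤ L) (hc : 0 < c) (h : c * L * X ≤ 1) :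
    X ≤ κ / c := by
  have hL0 : 0 < L := lt_of_lt_of_le (by positivity) hκL
  have hκL' : 1 ≤ κ * L := by rw [div_le_iff₀ hκ] at hκL; linarith
  rw [le_div_iff₀ hc]
  have h1 : X * c ≤ 1 / L := by
    rw [le_div_iff₀ (by positivity)]; linarith
  have h2 : 1 / L ≤ κ := by
    rw [div_le_iff₀ (by positivity)]; linarith
  linarith

/-- Positivity of `r` in the final regime. [folklore] -/
theorem r_pos_of_regime {L δ r : ℝ} (hL : 1 ≤ L) (hδ : 0 < δ) (hr' : L ^ 1000 ≤ δ ^ 10 * r) : 0 < r := by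
  have hd : 0 < δ ^ 10 := by positivity
  by_contra h
  push Not at h
  have := mul_le_mul_of_nonneg_left h hd.le
  have : (0 : ℝ) < L ^ 1000 := by positivity
  linarith

/-- `L¹⁰⁰⁰ ≤ r` in the final regime. [folklore] -/
theorem r_ge_of_regime {L δ r : ℝ} (hL : 1 ≤ L) (hδ : 0 < δ) (hδ1 : δ ≤ 1) (hr' : L ^ 1000 ≤ δ ^ 10 * r) :
    L ^ 1000 ≤ r := by
  have hr0 := r_pos_of_regime hL hδ hr'
  calc L ^ 1000 ≤ δ ^ 10 * r := hr'
    _ ≤ 1 * r := mul_le_mul_of_nonneg_right (pow_le_one₀ hδ.le hδ1) hr0.le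
    _ = r := one_mul r

/-- **Elementary facts in the final regime.** [folklore] -/
theorem basic_conds {L δ r ε : ℝ} (hL : 239000000 ≤ L) (hδ : 0 < δ) (hδ1 : δ ≤ 1) (hr' : L ^ 1000 ≤ δ ^ 10 * r)
    (hε0 : 0 ≤ ε) (hε' : L ^ 1000 * ε ≤ δ) :
    ε ≤ 1 / 20 ∧ 2 * ε < δ ∧ ε < 23 / 50 ∧ L ^ 400 ≤ r ∧ 47360000 ≤ r ∧ (192 : ℝ) ≤ r := by
  have hL1 : (1 : ℝ) ≤ L := by linarith
  have hr : L ^ 1000 ≤ r := r_ge_of_regime hL1 hδ hδ1 hr'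
  have hLp : L ≤ L ^ 1000 := le_self_pow₀ hL1 (by norm_num)
  have hεL : L * ε ≤ δ := by
    calc L * ε ≤ L ^ 1000 * ε := mul_le_mul_of_nonneg_right hLp hε0
      _ ≤ δ := hε'
  have hε20 : ε ≤ 1 / 20 := by
    rw [le_div_iff₀ (by norm_num)]; nlinarith
  have hεδ : 2 * ε < δ := by
    have h4 : 4 * ε ≤ L * ε := mul_le_mul_of_nonneg_right (by linarith) hε0
    by_cases hε : ε = 0
    · rw [hε]; linarith
    · have hεp : 0 < ε := lt_of_le_of_ne hε0 (Ne.symm hε)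
      linarith
  refine ⟨hε20, hεδ, by linarith, (pow_le_pow_right₀ hL1 (by norm_num)).trans hr, ?_, ?_⟩
  · calc (47360000 : ℝ) ≤ L := by linarith
      _ ≤ L ^ 1000 := hLp
      _ ≤ r := hr
  · calc (192 : ℝ) ≤ L := by linarith
      _ ≤ L ^ 1000 := hLp
      _ ≤ r := hr

/-- **The base threshold**: `3·10⁶ε + 8·10⁴/(δ³r⁴) ≤ κ²/10¹¹`. [folklore] -/
theorem base_cond {κ L δ r ε : ℝ} (hL : 239000000 ≤ L) (hκ : 0 < κ) (hκL : 1 / κ ≤ L) (hδ : 0 < δ) (hδ1 : δ ≤ 1)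
    (hr' : L ^ 1000 ≤ δ ^ 10 * r) (hε0 : 0 ≤ ε) (hε' : L ^ 1000 * ε ≤ δ) :
    3000000 * ε + 80000 / (δ ^ 3 * r ^ 4) ≤ κ ^ 2 / 10 ^ 11 := by
  have hL1 : (1 : ℝ) ≤ L := by linarith
  refine le_kappa_sq_div hκ hκL (by norm_num) ?_
  have h1 : (2 * 10 ^ 11 * 3000000) * L ^ 2 * ε ≤ 1 :=
    killD2 (m := 3) hL1 hδ1 hε0 hε' (const_le_pow hL (by norm_num)) (by norm_num)
  have h2 : (2 * 10 ^ 11 * 80000) * L ^ 2 / (δ ^ 3 * r ^ 4) ≤ 1 :=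
    killB2 (m := 3) hL1 hδ hδ1 hr' (const_le_pow hL (by norm_num)) (by norm_num) (by norm_num)
  have e : 10 ^ 11 * L ^ 2 * (3000000 * ε + 80000 / (δ ^ 3 * r ^ 4)) =
      ((2 * 10 ^ 11 * 3000000) * L ^ 2 * ε) / 2 + ((2 * 10 ^ 11 * 80000) * L ^ 2 / (δ ^ 3 * r ^ 4)) / 2 := by ring
  rw [e]; linarith

/-- **The phase-one thresholds.** [folklore] -/
theorem phase1_conds {κ L δ r ε ξn εp Du : ℝ} (hL : 239000000 ≤ L) (hκ : 0 < κ) (hκL : 1 / κ ≤ L)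
    (hδ : 0 < δ) (hδ1 : δ ≤ 1) (hr' : L ^ 1000 ≤ δ ^ 10 * r) (hε0 : 0 ≤ ε) (hε' : L ^ 1000 * ε ≤ δ)
    (hξ0 : 0 ≤ ξn) (hξn : ξn ≤ L ^ 2 * ε + L ^ 2 / (δ ^ 3 * r ^ 4)) (hεp : εp ≤ L ^ 2 * ε + L ^ 2 / (δ ^ 3 * r ^ 4))
    (hDu : Du = L ^ 30 * ε + L ^ 250 / (δ ^ 3 * r ^ 2)) :
    ξn ≤ κ / (2 * 10 ^ 10) ∧ ξn ≤ 1 / L ^ 100 ∧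
    4000000 * (210000 * ((25 / 23) * (2 * Du + ξn) + 0)) ≤ κ / 16 ∧
    4000000 * (210000 * ((25 / 23) * (2 * Du + 1 / L ^ 100) + 1 / L ^ 100)) ≤ κ / 12 ∧
    Du ≤ 1 / 20 ∧ εp ≤ Du ∧ 1 / L ^ 100 ≤ (1 : ℝ) / 100 ∧ 0 ≤ Du := by
  have hL1 : (1 : ℝ) ≤ L := by linarith
  have hL0 : (0 : ℝ) < L := by linarith
  have hr0 : 0 < r := r_pos_of_regime hL1 hδ hr'
  have hr : L ^ 1000 ≤ r := r_ge_of_regime hL1 hδ hδ1 hr'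
  have hr1 : 1 ≤ r := le_trans (one_le_pow₀ hL1) hr
  have hF0 : 0 ≤ L ^ 2 / (δ ^ 3 * r ^ 4) := by positivity
  have hDu0 : 0 ≤ Du := by rw [hDu]; positivity
  -- kills
  have k1 : (4 * 10 ^ 10) * L ^ 3 * ε ≤ 1 := killD2 (m := 2) hL1 hδ1 hε0 hε' (const_le_pow hL (by norm_num)) (by norm_num)
  have k2 : (4 * 10 ^ 10) * L ^ 3 / (δ ^ 3 * r ^ 4) ≤ 1 := killB2 (m := 2) hL1 hδ hδ1 hr' (const_le_pow hL (by norm_num)) (by norm_num) (by norm_num)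
  have k3 : 2 * L ^ 102 * ε ≤ 1 := killD2 (m := 1) hL1 hδ1 hε0 hε' (const_le_pow hL (by norm_num)) (by norm_num)
  have k4 : 2 * L ^ 102 / (δ ^ 3 * r ^ 4) ≤ 1 := killB2 (m := 1) hL1 hδ hδ1 hr' (const_le_pow hL (by norm_num)) (by norm_num) (by norm_num)
  have k5 : 8 * L ^ 33 * ε ≤ 1 := killD2 (m := 1) hL1 hδ1 hε0 hε' (const_le_pow hL (by norm_num)) (by norm_num)
  have k6 : 8 * L ^ 253 / (δ ^ 3 * r ^ 2) ≤ 1 := killB2 (m := 1) hL1 hδ hδ1 hr' (const_le_pow hL (by norm_num)) (by norm_num) (by norm_num)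
  have k7 : 8 * L ^ 5 * ε ≤ 1 := killD2 (m := 1) hL1 hδ1 hε0 hε' (const_le_pow hL (by norm_num)) (by norm_num)
  have k8 : 8 * L ^ 5 / (δ ^ 3 * r ^ 4) ≤ 1 := killB2 (m := 1) hL1 hδ hδ1 hr' (const_le_pow hL (by norm_num)) (by norm_num) (by norm_num)
  have k9 : 40 * L ^ 30 * ε ≤ 1 := killD2 (m := 1) hL1 hδ1 hε0 hε' (const_le_pow hL (by norm_num)) (by norm_num)
  have k10 : 40 * L ^ 250 / (δ ^ 3 * r ^ 2) ≤ 1 := killB2 (m := 1) hL1 hδ hδ1 hr' (const_le_pow hL (by norm_num)) (by norm_num) (by norm_num)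
  -- (a)
  have ha : ξn ≤ κ / (2 * 10 ^ 10) := by
    refine le_kappa_div hκ hκL (by norm_num) ?_
    have e : 2 * 10 ^ 10 * L * (L ^ 2 * ε + L ^ 2 / (δ ^ 3 * r ^ 4)) =
        ((4 * 10 ^ 10) * L ^ 3 * ε) / 2 + ((4 * 10 ^ 10) * L ^ 3 / (δ ^ 3 * r ^ 4)) / 2 := by ring
    have h := mul_le_mul_of_nonneg_left hξn (by positivity : (0 : ℝ) ≤ 2 * 10 ^ 10 * L)
    linarith
  -- (b)
  have hb : ξn ≤ 1 / L ^ 100 := by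
    rw [le_div_iff₀ (by positivity)]
    have e : (L ^ 2 * ε + L ^ 2 / (δ ^ 3 * r ^ 4)) * L ^ 100 = (2 * L ^ 102 * ε) / 2 + (2 * L ^ 102 / (δ ^ 3 * r ^ 4)) / 2 := by ring
    have h := mul_le_mul_of_nonneg_right hξn (by positivity : (0 : ℝ) ≤ L ^ 100)
    linarith
  -- 2Du + ξn and 2Du + 2/L¹⁰⁰ are ≤ 1/L³-ish
  have hL2 : (239000000 : ℝ) ^ 2 ≤ L ^ 2 := pow_le_pow_left₀ (by norm_num) hL 2
  have hsum1 : L ^ 3 * (2 * Du + ξn) ≤ 1 := by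
    rw [hDu]
    have e : L ^ 3 * (2 * (L ^ 30 * ε + L ^ 250 / (δ ^ 3 * r ^ 2)) + (L ^ 2 * ε + L ^ 2 / (δ ^ 3 * r ^ 4))) =
        (8 * L ^ 33 * ε) / 4 + (8 * L ^ 253 / (δ ^ 3 * r ^ 2)) / 4 + (8 * L ^ 5 * ε) / 8 + (8 * L ^ 5 / (δ ^ 3 * r ^ 4)) / 8 := by
      ring
    have h := mul_le_mul_of_nonneg_left hξn (by positivity : (0 : ℝ) ≤ L ^ 3)
    nlinarith [h, e, k5, k6, k7, k8]
  have hsum2 : L ^ 3 * (2 * Du + 2 / L ^ 100) ≤ 1 := by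
    rw [hDu]
    have e : L ^ 3 * (2 * (L ^ 30 * ε + L ^ 250 / (δ ^ 3 * r ^ 2))) =
        (8 * L ^ 33 * ε) / 4 + (8 * L ^ 253 / (δ ^ 3 * r ^ 2)) / 4 := by ring
    have h2 : L ^ 3 * (2 / L ^ 100) ≤ 1 / 4 := by
      rw [show L ^ 3 * (2 / L ^ 100) = 2 * L ^ 3 / L ^ 100 by ring, div_le_div_iff₀ (by positivity) (by norm_num)]
      calc 2 * L ^ 3 * 4 = 8 * L ^ 3 := by ring
        _ ≤ L * L ^ 3 := mul_le_mul_of_nonneg_right (by linarith) (by positivity)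
        _ = L ^ 4 := by ring
        _ ≤ L ^ 100 := pow_le_pow_right₀ hL1 (by norm_num)
        _ = 1 * L ^ 100 := (one_mul _).symm
    have e2 : L ^ 3 * (2 * (L ^ 30 * ε + L ^ 250 / (δ ^ 3 * r ^ 2)) + 2 / L ^ 100) =
        L ^ 3 * (2 * (L ^ 30 * ε + L ^ 250 / (δ ^ 3 * r ^ 2))) + L ^ 3 * (2 / L ^ 100) := by ring
    rw [e2, e]; linarith
  -- (c)
  have hc : 4000000 * (210000 * ((25 / 23) * (2 * Du + ξn) + 0)) ≤ κ / 16 := by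
    refine le_kappa_div hκ hκL (by norm_num) ?_
    have h0 : 0 ≤ 2 * Du + ξn := by positivity
    calc 16 * L * (4000000 * (210000 * ((25 / 23) * (2 * Du + ξn) + 0))) = (16 * 4000000 * 210000 * (25 / 23)) * L * (2 * Du + ξn) := by ring
      _ ≤ L ^ 2 * L * (2 * Du + ξn) := by
          refine mul_le_mul_of_nonneg_right (mul_le_mul_of_nonneg_right (le_trans (by norm_num) hL2) hL0.le) h0
      _ = L ^ 3 * (2 * Du + ξn) := by ring
      _ ≤ 1 := hsum1
  -- (d)
  have hd : 4000000 * (210000 * ((25 / 23) * (2 * Du + 1 / L ^ 100) + 1 / L ^ 100)) ≤ κ / 12 := by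
    refine le_kappa_div hκ hκL (by norm_num) ?_
    have h0 : 0 ≤ 2 * Du + 2 / L ^ 100 := by positivity
    have hmono : (25 / 23) * (2 * Du + 1 / L ^ 100) + 1 / L ^ 100 ≤ (25 / 23) * (2 * Du + 2 / L ^ 100) := by
      have : 0 ≤ 1 / L ^ 100 := by positivity
      have e : (2 : ℝ) / L ^ 100 = 2 * (1 / L ^ 100) := by ring
      rw [e]; linarith
    calc 12 * L * (4000000 * (210000 * ((25 / 23) * (2 * Du + 1 / L ^ 100) + 1 / L ^ 100)))
        ≤ 12 * L * (4000000 * (210000 * ((25 / 23) * (2 * Du + 2 / L ^ 100)))) := by gcongr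
      _ = (12 * 4000000 * 210000 * (25 / 23)) * L * (2 * Du + 2 / L ^ 100) := by ring
      _ ≤ L ^ 2 * L * (2 * Du + 2 / L ^ 100) := by
          refine mul_le_mul_of_nonneg_right (mul_le_mul_of_nonneg_right (le_trans (by norm_num) hL2) hL0.le) h0
      _ = L ^ 3 * (2 * Du + 2 / L ^ 100) := by ring
      _ ≤ 1 := hsum2
  -- (e) (f) (g)
  have he : Du ≤ 1 / 20 := by
    rw [hDu]
    have e : L ^ 30 * ε + L ^ 250 / (δ ^ 3 * r ^ 2) = (40 * L ^ 30 * ε) / 40 + (40 * L ^ 250 / (δ ^ 3 * r ^ 2)) / 40 := by ring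
    rw [e]; linarith
  have hf : εp ≤ Du := by
    rw [hDu]
    refine hεp.trans (add_le_add ?_ ?_)
    · exact mul_le_mul_of_nonneg_right (pow_le_pow_right₀ hL1 (by norm_num)) hε0
    · rw [div_le_div_iff₀ (by positivity) (by positivity)]
      have h1 : L ^ 2 ≤ L ^ 250 := pow_le_pow_right₀ hL1 (by norm_num)
      have h2 : r ^ 2 ≤ r ^ 4 := pow_le_pow_right₀ hr1 (by norm_num)
      have hδ3 : 0 < δ ^ 3 := by positivity
      exact mul_le_mul h1 (mul_le_mul_of_nonneg_left h2 hδ3.le) (by positivity) (by positivity)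
  have hg : 1 / L ^ 100 ≤ (1 : ℝ) / 100 := by
    refine one_div_le_one_div_of_le (by norm_num) ?_
    exact le_trans (by linarith) (le_self_pow₀ hL1 (by norm_num))
  exact ⟨ha, hb, hc, hd, he, hf, hg, hDu0⟩

/-- **The smallness of the slope aggregate of phase one**: `L¹³(L³ε/r + L/(δ³r³)) ≤ κ²/10¹¹`. [folklore] -/
theorem hsmall_cond {κ L δ r ε : ℝ} (hL : 239000000 ≤ L) (hκ : 0 < κ) (hκL : 1 / κ ≤ L) (hδ : 0 < δ)
    (hδ1 : δ ≤ 1) (hr' : L ^ 1000 ≤ δ ^ 10 * r) (hε0 : 0 ≤ ε) (hε' : L ^ 1000 * ε ≤ δ) :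
    L ^ 13 * (L ^ 3 * ε / r + L / (δ ^ 3 * r ^ 3)) ≤ κ ^ 2 / 10 ^ 11 := by
  have hL1 : (1 : ℝ) ≤ L := by linarith
  have hr0 : 0 < r := r_pos_of_regime hL1 hδ hr'
  have hr1 : 1 ≤ r := le_trans (one_le_pow₀ hL1) (r_ge_of_regime hL1 hδ hδ1 hr')
  refine le_kappa_sq_div hκ hκL (by norm_num) ?_
  have h1 : (2 * 10 ^ 11) * L ^ 18 * ε ≤ 1 := killD2 (m := 2) hL1 hδ1 hε0 hε' (const_le_pow hL (by norm_num)) (by norm_num)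
  have h2 : (2 * 10 ^ 11) * L ^ 16 / (δ ^ 3 * r ^ 3) ≤ 1 :=
    killB2 (m := 2) hL1 hδ hδ1 hr' (const_le_pow hL (by norm_num)) (by norm_num) (by norm_num)
  have h3 : L ^ 3 * ε / r ≤ L ^ 3 * ε := div_le_self (by positivity) hr1
  have e : 10 ^ 11 * L ^ 2 * (L ^ 13 * (L ^ 3 * ε + L / (δ ^ 3 * r ^ 3))) =
      ((2 * 10 ^ 11) * L ^ 18 * ε) / 2 + ((2 * 10 ^ 11) * L ^ 16 / (δ ^ 3 * r ^ 3)) / 2 := by ring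
  have hmono : 10 ^ 11 * L ^ 2 * (L ^ 13 * (L ^ 3 * ε / r + L / (δ ^ 3 * r ^ 3))) ≤
      10 ^ 11 * L ^ 2 * (L ^ 13 * (L ^ 3 * ε + L / (δ ^ 3 * r ^ 3))) := by gcongr
  linarith

/-- **The final shape of `ν`** for `Du = L³⁰ε + L²⁵⁰/(δ³r²)`. [folklore] -/
theorem nu_final {L δ r ε ν : ℝ} (hL : 239000000 ≤ L) (hδ : 0 < δ) (hr : 0 < r)
    (hν : ν ≤ 2 * L ^ 2 * ((L ^ 30 * ε + L ^ 250 / (δ ^ 3 * r ^ 2)) / r ^ 3 + 1 / (δ ^ 3 * r ^ 5))) :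
    ν ≤ 2 * L ^ 32 * ε / r ^ 3 + 3 * L ^ 252 / (δ ^ 3 * r ^ 5) := by
  have hL1 : (1 : ℝ) ≤ L := by linarith
  have e : 2 * L ^ 2 * ((L ^ 30 * ε + L ^ 250 / (δ ^ 3 * r ^ 2)) / r ^ 3 + 1 / (δ ^ 3 * r ^ 5)) =
      2 * L ^ 32 * ε / r ^ 3 + (2 * L ^ 252 + 2 * L ^ 2) / (δ ^ 3 * r ^ 5) := by
    field_simp; ring
  rw [e] at hν
  refine hν.trans (add_le_add le_rfl (div_le_div_of_nonneg_right ?_ (by positivity)))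
  have : 2 * L ^ 2 ≤ L ^ 252 := by
    calc 2 * L ^ 2 ≤ L * L ^ 2 := mul_le_mul_of_nonneg_right (by linarith) (by positivity)
      _ = L ^ 3 := by ring
      _ ≤ L ^ 252 := pow_le_pow_right₀ hL1 (by norm_num)
  linarith

end Summit.AtomisticToContinuum.Crystallization.Theorems.ExcessDecayLiouville
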